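import Literature.AlgebraicGeometry.Kawanoue2007.WeakOrderMuTilde
import Literature.AlgebraicGeometry.Kawanoue2007.IdealisticFiltrationGenerators
import Literature.AlgebraicGeometry.Kawanoue2007.IdealisticFiltrationLocalization
import Mathlib.Data.ENNReal.Real
import Mathlib.Data.ENNReal.BigOperators
import Mathlib.Algebra.Order.BigOperators.Group.Finset
import HarnessLib

/-!
# Kawanoue–Matsuki 2010 (IFP Part II), Rem. 3.1.1.2: `ord_ℋ` is weakly multiplicative and `μ̃ = μ_ℋ(G(T))` is attained on the generators — PROVED

H. Kawanoue, K. Matsuki, *Toward resolution of singularities over a field of positive characteristic (the Idealistic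
Filtration Program). Part II. Basic invariants associated to the idealistic filtration and their properties*, Publ.
RIMS **46** (2010) 359–422 (= arXiv:math/0612008) [KawanoueMatsuki2010], §3.1.1, **Remark 3.1.1.2 (1)(2)** (held
arXiv text `lit read paper:arxiv-math-0612008`, chunk p0042 L13–L40, re-read before typing), with H. Kawanoue, Publ.
RIMS **43** (2007) = arXiv:math/0607009 [Kawanoue2007], Def. 3.2.2.1 (`ord_ℋ`, `μ_ℋ`, `μ̃`; tree
`Kawanoue2007/WeakOrderMuTilde.lean`) and Lemma 2.2.1.2 (1) (explicit levels of `G(T)`; tree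
`Kawanoue2007/IdealisticFiltrationGenerators.lean`). Campaign `res-hironaka` (D-0089), rung LIT-6; sibling of
`InvariantsAtClosedPoint.lean` (the pointwise FACTS). This file is a PROOF file: theorems only, NO definitions, NO named
facts. It proves the formula by which `μ̃` is actually COMPUTED (by the authors in Rem. 3.1.1.2 (2), and by every
numerical hand of the campaign): for a filtration given by generators, `μ_ℋ` is the infimum of `ord_ℋ(f_λ)/a_λ` over
the generators of positive level. Nothing of Hironaka's 2017 manuscript is referred to or asserted.

## What is proved (faithfulness notes)

* **Rem. 3.1.1.2 (1)** (p0042 L13–L21): «the order modulo `(ℋ)` is only weakly multiplicative in the sense that we have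
  an inequality `ord(fg) ≥ ord(f) + ord(g)`» = `add_ordMod_le_ordMod_mul` (for ANY ideal `I` of a local ring in place
  of `(ℋ)`; with `min_ordMod_le_ordMod_add`, `ordMod_le_ordMod_mul_left`, `nsmul_ordMod_le_ordMod_pow`,
  `sum_mul_ordMod_le_ordMod_prod_pow`). The equality cases («multiplicative … if `e_1 = ⋯ = e_N = 0`»; strict for some
  `f, g` if some `e_l > 0`, Rem. 3.2.1.2 (1)) are NOT proved here.
* **Rem. 3.1.1.2 (2)** (p0042 L22–L40), the displayed computation «`μ̃(P) = μ_ℋ(𝕀_P) = inf{ ord_ℋ(f)/a ; (f, a) ∈ 𝕀_P,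
  a > 0 } = min{ μ_ℋ(f_λ, a_λ) = ord_ℋ(f_λ)/a_λ = ord_ℋ(f_λ)·q_λ/p_λ } (cf. Remark 3.1.1.2 (1) above)`» for
  `𝕀 = G_R(T)`, `T = {(f_λ, a_λ)}_{λ ∈ Λ}` finite: = **`muMod_generate`** (`μ_I(G(T)) = ⨅_{(f, a) ∈ T, a > 0} ord_I(f)/a`
  for EVERY `T ⊂ R × ℝ` and every ideal `I` of a local ring; `inf` = `min` for finite `T`), its `μ̃`-form
  `muTilde_generate`, and — through Kawanoue 2007 Prop. 2.4.2.1 (1) `G_R(T)_P = G_{R_P}(T)`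
  (`IdealisticFiltration.atPrime_generate`) — the pointwise form `muTilde_atPrime_generate` for `𝕀_P` with `𝕀 = G_R(T)`
  given over the coordinate ring, exactly the printed situation. The proof is the one the print indicates: the level
  `G(T)_a` is generated by the monomials `∏ f_λ^{n_λ}`, `Σ n_λ a_λ ≥ a` (Lemma 2.2.1.2 (1)), and by (1)
  `ord_ℋ(∏ f_λ^{n_λ}) ≥ Σ n_λ ord_ℋ(f_λ) ≥ μ₀ Σ_{a_λ > 0} n_λ a_λ ≥ μ₀ a`, `μ₀` the infimum over the generators. The
  concluding clause «`∈ (1/δ) ℤ_{≥0} ∪ {∞}`, `δ = ∏ p_λ`» (bounded denominators AT A FIXED STAGE) is an arithmetic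
  consequence of the formula for rational levels; it is NOT typed here (`-- TODO(general form)` below), nor is any
  statement about denominators ALONG a sequence of transformations (the open point of the programme, Part I §0.3).

## References

* H. Kawanoue, K. Matsuki, Publ. RIMS 46 (2010) 359–422 = arXiv:math/0612008: Rem. 3.1.1.2 (1)(2), Def. 3.1.1.1.
  [KawanoueMatsuki2010]
* H. Kawanoue, Publ. RIMS 43 (2007) 819–909 = arXiv:math/0607009: Def. 3.2.2.1, Lemma 2.2.1.2 (1), Prop. 2.4.2.1 (1).
  [Kawanoue2007]
-/

noncomputable section

namespace Literature.AlgebraicGeometry.KawanoueMatsuki2010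

open Literature.AlgebraicGeometry.Kawanoue2007
open IsLocalRing
open scoped ENNReal

/-! ## The order modulo `(ℋ)` is a weak valuation: superadditive and weakly multiplicative -/

section OrdModAlgebra

variable {R : Type*} [CommRing R] [IsLocalRing R] (I : Ideal R)

/-- `ord_ℋ` is superadditive: `min(ord_ℋ f, ord_ℋ g) ≤ ord_ℋ(f + g)` (each `𝔪ⁿ + (ℋ)` is an ideal).
[cite: KawanoueMatsuki2010, Rem. 3.1.1.2 (1); Kawanoue2007, Def. 3.2.2.1] -/
theorem min_ordMod_le_ordMod_add (f g : R) : min (ordMod I f) (ordMod I g) ≤ ordMod I (f + g) := by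
  refine ENat.forall_natCast_le_iff_le.mp fun n hn => ?_
  rw [le_min_iff] at hn
  rw [le_ordMod_iff]
  exact Ideal.add_mem _ ((le_ordMod_iff I f n).mp hn.1) ((le_ordMod_iff I g n).mp hn.2)

/-- `ord_ℋ f ≤ ord_ℋ(r f)` (each `𝔪ⁿ + (ℋ)` is an ideal). [cite: KawanoueMatsuki2010, Rem. 3.1.1.2 (1); Kawanoue2007, Def. 3.2.2.1] -/
theorem ordMod_le_ordMod_mul_left (r f : R) : ordMod I f ≤ ordMod I (r * f) := by
  refine ENat.forall_natCast_le_iff_le.mp fun n hn => ?_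
  rw [le_ordMod_iff] at hn ⊢
  exact Ideal.mul_mem_left _ r hn

/-- `(𝔪^a + I)(𝔪^b + I) ⊂ 𝔪^{a+b} + I`. [cite: KawanoueMatsuki2010, Rem. 3.1.1.2 (1)] -/
theorem pow_sup_mul_pow_sup_le (a b : ℕ) :
    (maximalIdeal R ^ a ⊔ I) * (maximalIdeal R ^ b ⊔ I) ≤ maximalIdeal R ^ (a + b) ⊔ I := by
  rw [Ideal.sup_mul, Ideal.mul_sup, Ideal.mul_sup, ← pow_add]
  refine sup_le (sup_le le_sup_left ?_) (sup_le ?_ ?_)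
  · exact Ideal.mul_le_left.trans le_sup_right
  · exact Ideal.mul_le_right.trans le_sup_right
  · exact Ideal.mul_le_right.trans le_sup_right

/-- **Rem. 3.1.1.2 (1): `ord_ℋ` is weakly multiplicative** — «the order modulo `(ℋ)` is only weakly multiplicative in the
sense that we have an inequality `ord(fg) ≥ ord(f) + ord(g)` `∀ f, g ∈ R_P`» (with equality when all `e_l = 0`, not
proved here; strict for some `f, g` when some `e_l > 0`, Rem. 3.2.1.2 (1)). Proved for any ideal `I` of a local ring.
[cite: KawanoueMatsuki2010, Rem. 3.1.1.2 (1)] -/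
theorem add_ordMod_le_ordMod_mul (f g : R) : ordMod I f + ordMod I g ≤ ordMod I (f * g) := by
  have key : ∀ a b : ℕ, (a : ℕ∞) ≤ ordMod I f → (b : ℕ∞) ≤ ordMod I g →
      ((a + b : ℕ) : ℕ∞) ≤ ordMod I (f * g) := by
    intro a b ha hb
    rw [le_ordMod_iff] at ha hb ⊢
    exact pow_sup_mul_pow_sup_le I a b (Ideal.mul_mem_mul ha hb)
  rcases eq_or_ne (ordMod I f) ⊤ with hf | hf
  · have h : ordMod I (f * g) = ⊤ := by
      refine ENat.eq_top_iff_forall_ge.mpr fun a => ?_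
      have := key a 0 (by rw [hf]; exact le_top) (by simp)
      simpa using this
    rw [h]; exact le_top
  rcases eq_or_ne (ordMod I g) ⊤ with hg | hg
  · have h : ordMod I (f * g) = ⊤ := by
      refine ENat.eq_top_iff_forall_ge.mpr fun b => ?_
      have := key 0 b (by simp) (by rw [hg]; exact le_top)
      simpa using this
    rw [h]; exact le_top
  obtain ⟨a, ha⟩ := ENat.ne_top_iff_exists.mp hf
  obtain ⟨b, hb⟩ := ENat.ne_top_iff_exists.mp hg
  have := key a b ha.le hb.le
  rw [← ha, ← hb]
  exact_mod_cast this

/-- `n · ord_ℋ(f) ≤ ord_ℋ(fⁿ)` (iterate weak multiplicativity). [cite: KawanoueMatsuki2010, Rem. 3.1.1.2 (1)] -/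
theorem nsmul_ordMod_le_ordMod_pow (f : R) (n : ℕ) : (n : ℕ∞) * ordMod I f ≤ ordMod I (f ^ n) := by
  induction n with
  | zero => simp
  | succ n ih =>
    calc ((n + 1 : ℕ) : ℕ∞) * ordMod I f = (n : ℕ∞) * ordMod I f + ordMod I f := by push_cast; ring
      _ ≤ ordMod I (f ^ n) + ordMod I f := add_le_add ih le_rfl
      _ ≤ ordMod I (f ^ n * f) := add_ordMod_le_ordMod_mul I _ _
      _ = ordMod I (f ^ (n + 1)) := by rw [pow_succ]

/-- `Σ k_x · ord_ℋ(f_x) ≤ ord_ℋ(∏ f_x^{k_x})`. [cite: KawanoueMatsuki2010, Rem. 3.1.1.2 (1)] -/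
theorem sum_mul_ordMod_le_ordMod_prod_pow {α : Type*} (s : Finset α) (f : α → R) (k : α → ℕ) :
    ∑ x ∈ s, (k x : ℕ∞) * ordMod I (f x) ≤ ordMod I (∏ x ∈ s, f x ^ k x) := by
  classical
  induction s using Finset.induction_on with
  | empty => simp
  | insert x s hx ih =>
    rw [Finset.sum_insert hx, Finset.prod_insert hx]
    calc (k x : ℕ∞) * ordMod I (f x) + ∑ y ∈ s, (k y : ℕ∞) * ordMod I (f y)
        ≤ ordMod I (f x ^ k x) + ordMod I (∏ y ∈ s, f y ^ k y) :=
          add_le_add (nsmul_ordMod_le_ordMod_pow I _ _) ih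
      _ ≤ ordMod I (f x ^ k x * ∏ y ∈ s, f y ^ k y) := add_ordMod_le_ordMod_mul I _ _

/-- For a monomial `∏ f_λ^{n_λ}` in the generators (Kawanoue 2007 Lemma 2.2.1.2 (1)):
`Σ n_λ · ord_ℋ(f_λ) ≤ ord_ℋ(∏ f_λ^{n_λ})`. [cite: KawanoueMatsuki2010, Rem. 3.1.1.2 (1)(2); Kawanoue2007, Lemma 2.2.1.2 (1)] -/
theorem sum_mul_ordMod_le_ordMod_monomialOf (n : (R × ℝ) →₀ ℕ) :
    ∑ x ∈ n.support, (n x : ℕ∞) * ordMod I x.1 ≤ ordMod I (IdealisticFiltration.monomialOf n) :=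
  sum_mul_ordMod_le_ordMod_prod_pow I n.support (fun x => x.1) n

/-- A lower bound on `ord_ℋ` valid on a set `S ⊂ R` stays valid on the ideal `S` generates (values compared in
`[0, ∞]`, where `μ̃` lives): `ord_ℋ` is superadditive and monotone under multiplication by ring elements.
[cite: KawanoueMatsuki2010, Rem. 3.1.1.2 (1)(2)] -/
theorem le_ordMod_of_mem_span {S : Set R} {C : ℝ≥0∞}
    (hS : ∀ m ∈ S, C ≤ ((ordMod I m : ℕ∞) : ℝ≥0∞)) {g : R} (hg : g ∈ Ideal.span S) :
    C ≤ ((ordMod I g : ℕ∞) : ℝ≥0∞) := by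
  induction hg using Submodule.span_induction with
  | mem x hx => exact hS x hx
  | zero => simp
  | add x y _ _ hx hy =>
    calc C ≤ min ((ordMod I x : ℕ∞) : ℝ≥0∞) ((ordMod I y : ℕ∞) : ℝ≥0∞) := le_min hx hy
      _ = ((min (ordMod I x) (ordMod I y) : ℕ∞) : ℝ≥0∞) := (ENat.toENNReal_min _ _).symm
      _ ≤ ((ordMod I (x + y) : ℕ∞) : ℝ≥0∞) := ENat.toENNReal_le.mpr (min_ordMod_le_ordMod_add I x y)
  | smul r x _ hx =>
    exact hx.trans (ENat.toENNReal_le.mpr (ordMod_le_ordMod_mul_left I r x))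

end OrdModAlgebra

/-- The coercion `ℕ∞ → [0, ∞]` commutes with finite sums (it is a ring homomorphism, Mathlib
`ENat.toENNRealRingHom`). [folklore] -/
private theorem enat_toENNReal_finset_sum {α : Type*} (s : Finset α) (F : α → ℕ∞) :
    ((∑ x ∈ s, F x : ℕ∞) : ℝ≥0∞) = ∑ x ∈ s, ((F x : ℕ∞) : ℝ≥0∞) :=
  map_sum ENat.toENNRealRingHom F s

/-! ## `μ_ℋ(G(T))` is attained on the generators -/

section Generators

variable {R : Type*} [CommRing R] [IsLocalRing R] (I : Ideal R)

open IdealisticFiltration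

omit [CommRing R] [IsLocalRing R] in
/-- The weight `Σ n_λ a_λ` of an exponent vector is at most the partial weight over the generators of POSITIVE
level (the other terms are `≤ 0`). [cite: Kawanoue2007, Lemma 2.2.1.2 (1)] -/
theorem weightOf_le_sum_filter_pos (n : (R × ℝ) →₀ ℕ) :
    weightOf n ≤ ∑ x ∈ n.support with 0 < x.2, (n x : ℝ) * x.2 := by
  classical
  unfold weightOf Finsupp.sum
  rw [← Finset.sum_filter_add_sum_filter_not n.support (fun x : R × ℝ => 0 < x.2)]
  have hle : ∑ x ∈ n.support with ¬ 0 < x.2, (n x : ℝ) * x.2 ≤ 0 :=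
    Finset.sum_nonpos fun x hx =>
      mul_nonpos_of_nonneg_of_nonpos (Nat.cast_nonneg _) (not_lt.mp (Finset.mem_filter.mp hx).2)
  linarith

/-- **`μ_ℋ` of a generated filtration is attained on the generators** [KM 2010, Rem. 3.1.1.2 (2), the displayed
computation «`μ_ℋ(𝕀_P) = inf { ord_ℋ(f)/a ; (f, a) ∈ 𝕀_P, a > 0 } = min { μ_ℋ(f_λ, a_λ) = ord_ℋ(f_λ)/a_λ }` (cf.
Remark 3.1.1.2 (1) above)» for `𝕀 = G_R(T)`, `T = {(f_λ, a_λ)}`]: for every ideal `I` (`= (ℋ)`) of a local ring and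
EVERY subset `T ⊂ R × ℝ`, `μ_I(G(T)) = inf { ord_I(f)/a ; (f, a) ∈ T, a > 0 }` (an `inf` over the generators of
positive level; a `min` when `T` is finite). Proof as indicated in print: `G(T)_a` is generated by the monomials
`∏ f_λ^{n_λ}` with `Σ n_λ a_λ ≥ a` (Kawanoue 2007, Lemma 2.2.1.2 (1) = `level_generate_eq_span`), and weak
multiplicativity (Rem. 3.1.1.2 (1)) bounds their orders from below. No saturation or regularity hypothesis is used.
[cite: KawanoueMatsuki2010, Rem. 3.1.1.2 (2); Kawanoue2007, Lemma 2.2.1.2 (1), Def. 3.2.2.1] -/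
theorem muMod_generate (T : Set (R × ℝ)) :
    muMod I (generate T).carrier = ⨅ x ∈ {x : R × ℝ | x ∈ T ∧ 0 < x.2}, muModElem I x.1 x.2 := by
  apply le_antisymm
  · exact le_iInf₂ fun x hx => muMod_le_muModElem I (subset_carrier_generate T hx.1) hx.2
  · set μ₀ := ⨅ x ∈ {x : R × ℝ | x ∈ T ∧ 0 < x.2}, muModElem I x.1 x.2 with hμ₀
    rw [le_muMod_iff]
    intro g a hga ha
    rw [mem_carrier_iff] at hga
    change g ∈ (generate T).level a at hga
    rw [level_generate_eq_span] at hga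
    have ha0 : ENNReal.ofReal a ≠ 0 := (ENNReal.ofReal_pos.mpr ha).ne'
    unfold muModElem
    rw [ENNReal.le_div_iff_mul_le (Or.inl ha0) (Or.inl ENNReal.ofReal_ne_top)]
    refine le_ordMod_of_mem_span I (fun m hm => ?_) hga
    obtain ⟨n, hn, hwa, rfl⟩ := hm
    classical
    -- each generator of positive level: `μ₀ · a_λ ≤ ord_ℋ(f_λ)`
    have hgen : ∀ x ∈ n.support.filter (fun x : R × ℝ => 0 < x.2),
        μ₀ * ((n x : ℝ≥0∞) * ENNReal.ofReal x.2) ≤ (n x : ℝ≥0∞) * ((ordMod I x.1 : ℕ∞) : ℝ≥0∞) := by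
      intro x hx
      have hxT : x ∈ T := hn (Finset.mem_coe.mpr (Finset.mem_filter.mp hx).1)
      have hx2 : 0 < x.2 := (Finset.mem_filter.mp hx).2
      have hμ : μ₀ ≤ muModElem I x.1 x.2 := iInf₂_le x ⟨hxT, hx2⟩
      unfold muModElem at hμ
      rw [ENNReal.le_div_iff_mul_le (Or.inl (ENNReal.ofReal_pos.mpr hx2).ne')
        (Or.inl ENNReal.ofReal_ne_top)] at hμ
      calc μ₀ * ((n x : ℝ≥0∞) * ENNReal.ofReal x.2) = (n x : ℝ≥0∞) * (μ₀ * ENNReal.ofReal x.2) := by ring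
        _ ≤ (n x : ℝ≥0∞) * ((ordMod I x.1 : ℕ∞) : ℝ≥0∞) := by gcongr
    calc μ₀ * ENNReal.ofReal a
        ≤ μ₀ * ENNReal.ofReal (∑ x ∈ n.support with 0 < x.2, (n x : ℝ) * x.2) := by
          gcongr
          exact hwa.trans (weightOf_le_sum_filter_pos n)
      _ = ∑ x ∈ n.support with 0 < x.2, μ₀ * ((n x : ℝ≥0∞) * ENNReal.ofReal x.2) := by
          rw [ENNReal.ofReal_sum_of_nonneg (fun x hx =>
            mul_nonneg (Nat.cast_nonneg _) (le_of_lt (Finset.mem_filter.mp hx).2)), Finset.mul_sum]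
          refine Finset.sum_congr rfl fun x _ => ?_
          rw [ENNReal.ofReal_mul (Nat.cast_nonneg _), ENNReal.ofReal_natCast]
      _ ≤ ∑ x ∈ n.support with 0 < x.2, (n x : ℝ≥0∞) * ((ordMod I x.1 : ℕ∞) : ℝ≥0∞) :=
          Finset.sum_le_sum hgen
      _ ≤ ∑ x ∈ n.support, (n x : ℝ≥0∞) * ((ordMod I x.1 : ℕ∞) : ℝ≥0∞) :=
          Finset.sum_le_sum_of_subset_of_nonneg (Finset.filter_subset _ _) fun _ _ _ => bot_le
      _ = ((∑ x ∈ n.support, (n x : ℕ∞) * ordMod I x.1 : ℕ∞) : ℝ≥0∞) := by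
          rw [enat_toENNReal_finset_sum]
          refine Finset.sum_congr rfl fun x _ => ?_
          rw [ENat.toENNReal_mul, ENat.toENNReal_coe]
      _ ≤ ((ordMod I (monomialOf n) : ℕ∞) : ℝ≥0∞) :=
          ENat.toENNReal_le.mpr (sum_mul_ordMod_le_ordMod_monomialOf I n)

end Generators


/-! ## The `μ̃`-forms: `μ̃` of `G(T)` and of `G_R(T)_P` read on a family `ℋ` -/

section MuTilde

variable {R : Type*} [CommRing R] [IsLocalRing R]

open IdealisticFiltration

/-- **`μ̃ = μ_ℋ(G(T))` on the generators**: for any family `h` (the elements of an LGS; `(ℋ) = span (range h)`) and any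
`T ⊂ R × ℝ` over a local ring, `μ_ℋ(G(T)) = ⨅_{(f, a) ∈ T, a > 0} ord_ℋ(f)/a`.
[cite: KawanoueMatsuki2010, Rem. 3.1.1.2 (2); Kawanoue2007, Def. 3.2.2.1] -/
theorem muTilde_generate (T : Set (R × ℝ)) {ι : Type*} (h : ι → R) :
    muTilde (generate T) h =
      ⨅ x ∈ {x : R × ℝ | x ∈ T ∧ 0 < x.2}, muModElem (Ideal.span (Set.range h)) x.1 x.2 :=
  muMod_generate _ T

/-- A single generator of positive level: `μ_ℋ(G({(f, a)})) = ord_ℋ(f)/a`.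
[cite: KawanoueMatsuki2010, Rem. 3.1.1.2 (2)] -/
theorem muMod_generate_singleton (I : Ideal R) (f : R) {a : ℝ} (ha : 0 < a) :
    muMod I (generate {(f, a)}).carrier = muModElem I f a := by
  rw [muMod_generate]
  apply le_antisymm
  · exact iInf₂_le (f, a) ⟨Set.mem_singleton _, ha⟩
  · refine le_iInf₂ fun x hx => ?_
    obtain ⟨hx, -⟩ := hx
    rw [Set.mem_singleton_iff.mp hx]

end MuTilde

section AtPrime

variable {A : Type*} [CommRing A]

open IdealisticFiltration

omit [CommRing A] in
/-- Re-indexing an infimum over the image `φ(T) = {(φ f, a)}` by `T` itself. [folklore] -/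
private theorem iInf_image_prodMap_eq {S : Type*} (φ : A → S) (T : Set (A × ℝ)) (F : S → ℝ → ℝ≥0∞) :
    ⨅ y ∈ {y : S × ℝ | y ∈ Prod.map φ id '' T ∧ 0 < y.2}, F y.1 y.2 =
      ⨅ x ∈ {x : A × ℝ | x ∈ T ∧ 0 < x.2}, F (φ x.1) x.2 := by
  apply le_antisymm
  · refine le_iInf₂ fun x hx => ?_
    exact iInf₂_le (Prod.map φ id x) ⟨⟨x, hx.1, rfl⟩, hx.2⟩
  · refine le_iInf₂ fun y hy => ?_
    obtain ⟨⟨x, hxT, rfl⟩, hy2⟩ := hy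
    exact iInf₂_le x ⟨hxT, hy2⟩

/-- **The printed situation of Rem. 3.1.1.2 (2)**: `𝕀 = G_R(T)` given over the ring `R` (= `A`), `P` a prime
(a closed point in print), `𝕀_P = G_{R_P}(T)` its localization (Kawanoue 2007 Prop. 2.4.2.1 (1),
`IdealisticFiltration.atPrime_generate`), `ℋ` a family in `R_P`: then
«`μ̃(P) = μ_ℋ(𝕀_P) = inf{…} = min{ ord_ℋ(f_λ)/a_λ }`» — `μ_ℋ(𝕀_P) = ⨅_{(f, a) ∈ T, a > 0} ord_ℋ(f/1)/a`, the orders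
taken in `R_P` modulo `(ℋ)`. For `μ̃(P)` proper `ℋ` is an LGS of `𝕀_P` (Def. 3.1.1.1); the formula holds for any family.
-- TODO(general form): the concluding clause «`μ̃(P) ∈ (1/δ)ℤ_{≥0} ∪ {∞}`, `δ = ∏ p_λ`» for rational levels `a_λ = p_λ/q_λ`.
[cite: KawanoueMatsuki2010, Rem. 3.1.1.2 (2), Def. 3.1.1.1; Kawanoue2007, Prop. 2.4.2.1 (1)] -/
theorem muTilde_atPrime_generate (T : Set (A × ℝ)) (P : Ideal A) [P.IsPrime] {ι : Type*}
    (h : ι → Localization.AtPrime P) :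
    muTilde ((generate T).atPrime P) h =
      ⨅ x ∈ {x : A × ℝ | x ∈ T ∧ 0 < x.2},
        muModElem (Ideal.span (Set.range h)) (algebraMap A (Localization.AtPrime P) x.1) x.2 := by
  rw [atPrime_generate, muTilde_generate]
  exact iInf_image_prodMap_eq _ T _

/-- The same formula for the pointwise invariant of `InvariantsAtClosedPoint.lean`-style readings: `μ_ℋ((G_R T)_P)`
as `muMod` of the carrier. [cite: KawanoueMatsuki2010, Rem. 3.1.1.2 (2)] -/
theorem muMod_atPrime_generate (T : Set (A × ℝ)) (P : Ideal A) [P.IsPrime] (I : Ideal (Localization.AtPrime P)) :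
    muMod I ((generate T).atPrime P).carrier =
      ⨅ x ∈ {x : A × ℝ | x ∈ T ∧ 0 < x.2}, muModElem I (algebraMap A (Localization.AtPrime P) x.1) x.2 := by
  rw [atPrime_generate, muMod_generate]
  exact iInf_image_prodMap_eq _ T _

end AtPrime

end Literature.AlgebraicGeometry.KawanoueMatsuki2010

end
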